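import Literature.Probability.LatticeModels.CircleWeightBondModel
import Literature.Probability.LatticeModels.LatticePathChains
import Literature.Probability.LatticeModels.XYTorusFreeBoxComparison
import HarnessLib

/-!
# Pushing path ensembles forward along injective bond maps; balls of `ℤ^d` inside the torus

Model-independent plumbing for running Garban–Spencer's path estimator
(arXiv:2109.01617, §2, Step 1) on the bond system of the space-time torus
(`JCurrent.bondSystem d L M`, `CircleWeightBondModel.lean`) with the tree's ball-path ensembles,
which live on the free bond system `latticeBonds Λ` of a region `Λ ⊂ ℤ^d` (`LatticePathChains`):

* `BondSystem.exists_unitChain_map` — a map of bond systems `(g, f, ε)` (`g` on vertices, `f`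
  INJECTIVE on bonds, signs `ε_a = ±1` with `χ'_{f a}(θ') = χ_a(θ' ∘ g)^{ε_a}`) pushes every family
  of unit chains from `x` to `y` to a family of unit chains from `g x` to `g y` with THE SAME pairwise
  overlaps (coefficients `ε_a T_a` on the image, `0` elsewhere);
* `exists_unitChain_latticeBonds_to_torus` — the instance `latticeBonds Λ → JCurrent.bondSystem d L M`,
  `z ↦ (π z, 0)`, available as soon as the projection `π = Torus.proj L` is injective on `Λ`
  (a bond `{u, u + eᵢ}` of `Λ` goes to the torus bond `((π u, 0), i)`, with sign `−1` when
  `latticeBonds` orients it downwards);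
* `exists_ball_finset` — the closed Euclidean ball `B((x+y)/2, 2‖x − y‖₂) ∩ ℤ^d` as a `Finset`;
  `torusProj_injOn_of_ball` — `π` is injective on it when `16‖x − y‖₂² < L²`.

Theorems only; no definitions.

## References

* C. Garban, T. Spencer, arXiv:2109.01617, proof of Theorem 1.3, Steps 1–2 (paths and the ball
  condition). [GarbanSpencer2022]
-/

noncomputable section

open Finset
open scoped BigOperators ComplexConjugate

namespace Literature.Probability.LatticeModels

/-! ### Pushforward of unit chains -/

namespace BondSystem

/-- **Pushforward of a path ensemble along an injective bond map.** Let `(g, f, ε)` map the bond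
system `G` to `G'`: `g : V → V'` on vertices, `f : ι → ι'` injective on bonds, and signs
`ε_a ∈ {1, −1}` such that `χ'_{f a}(θ') = χ_a(θ' ∘ g)^{ε_a}` for all `θ'`. Then every family
`T_s` of unit chains from `x` to `y` on `G` gives a family of unit chains from `g x` to `g y` on `G'`
with the same pairwise overlaps. [folklore] -/
theorem exists_unitChain_map {V ι V' ι' : Type*} [Fintype ι] [Fintype ι']
    (G : BondSystem V ι) (G' : BondSystem V' ι') (g : V → V') {f : ι → ι'}
    (hf : Function.Injective f) (ε : ι → ℤ) (hε : ∀ a, ε a = 1 ∨ ε a = -1)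
    (hcompat : ∀ a (θ' : V' → Circle),
      ((G'.bondChar (f a) θ' : Circle) : ℂ) = ((G.bondChar a (θ' ∘ g) : Circle) : ℂ) ^ ε a)
    {x y : V} {S : Type*} (T : S → G.UnitChain x y) :
    ∃ T' : S → G'.UnitChain (g x) (g y), ∀ s s', (T' s).overlap (T' s') = (T s).overlap (T s') := by
  classical
  -- the pushed-forward coefficients
  let c' : S → ι' → ℤ := fun s => Function.extend f (fun a => ε a * (T s).coeff a) (fun _ => 0)
  have hc'f : ∀ s a, c' s (f a) = ε a * (T s).coeff a := fun s a => hf.extend_apply _ _ a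
  have hc'0 : ∀ s a', (¬ ∃ a, f a = a') → c' s a' = 0 := fun s a' h => by
    show Function.extend f _ (fun _ => (0 : ℤ)) a' = 0
    rw [Function.extend_apply' _ _ _ h]
  have hε0 : ∀ a, ε a ≠ 0 := fun a => by rcases hε a with h | h <;> simp [h]
  have hεsq : ∀ a, ε a * ε a = 1 := fun a => by rcases hε a with h | h <;> simp [h]
  have hεabs : ∀ a, (ε a).natAbs = 1 := fun a => by rcases hε a with h | h <;> simp [h]
  refine ⟨fun s => ⟨c' s, ?_, ?_⟩, ?_⟩
  · intro a'
    by_cases h : ∃ a, f a = a'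
    · obtain ⟨a, rfl⟩ := h
      rw [hc'f, Int.natAbs_mul, hεabs, one_mul]; exact (T s).natAbs_le a
    · rw [hc'0 s a' h]; simp
  · intro θ'
    have hprod : ∏ a', ((G'.bondChar a' θ' : Circle) : ℂ) ^ c' s a' =
        ∏ a, ((G'.bondChar (f a) θ' : Circle) : ℂ) ^ c' s (f a) := by
      calc ∏ a', ((G'.bondChar a' θ' : Circle) : ℂ) ^ c' s a'
          = ∏ a' ∈ Finset.univ.image f, ((G'.bondChar a' θ' : Circle) : ℂ) ^ c' s a' := by
            symm
            refine Finset.prod_subset (Finset.subset_univ _) fun a' _ ha' => ?_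
            have : ¬ ∃ a, f a = a' := fun ⟨a, ha⟩ =>
              ha' (Finset.mem_image.2 ⟨a, Finset.mem_univ _, ha⟩)
            rw [hc'0 s a' this, zpow_zero]
        _ = _ := Finset.prod_image fun a _ b _ h => hf h
    rw [hprod]
    have key : ∀ a, ((G'.bondChar (f a) θ' : Circle) : ℂ) ^ c' s (f a) =
        ((G.bondChar a (θ' ∘ g) : Circle) : ℂ) ^ (T s).coeff a := fun a => by
      rw [hc'f, hcompat, ← zpow_mul, ← mul_assoc, hεsq, one_mul]
    simp_rw [key]
    rw [(T s).boundary (θ' ∘ g)]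
    rfl
  · intro s s'
    show #{a' | c' s a' ≠ 0 ∧ c' s' a' ≠ 0} = #{a | (T s).coeff a ≠ 0 ∧ (T s').coeff a ≠ 0}
    have hset : (Finset.univ.filter fun a' => c' s a' ≠ 0 ∧ c' s' a' ≠ 0) =
        (Finset.univ.filter fun a => (T s).coeff a ≠ 0 ∧ (T s').coeff a ≠ 0).image f := by
      ext a'
      simp only [Finset.mem_filter, Finset.mem_univ, true_and, Finset.mem_image]
      constructor
      · rintro ⟨h1, h2⟩
        by_cases h : ∃ a, f a = a'
        · obtain ⟨a, rfl⟩ := h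
          rw [hc'f] at h1 h2
          exact ⟨a, ⟨fun h0 => h1 (by rw [h0, mul_zero]), fun h0 => h2 (by rw [h0, mul_zero])⟩, rfl⟩
        · exact absurd (hc'0 s a' h) h1
      · rintro ⟨a, ⟨h1, h2⟩, rfl⟩
        rw [hc'f, hc'f]
        exact ⟨mul_ne_zero (hε0 a) h1, mul_ne_zero (hε0 a) h2⟩
    rw [hset, Finset.card_image_of_injective _ hf]

end BondSystem

/-! ### From a region of `ℤ^d` to the torus -/

section Torus

variable {d : ℕ}

/-- **Ball-path ensembles on the torus.** If the projection `π = Torus.proj L` is injective on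
`Λ ⊂ ℤ^d`, every family of unit chains from `x` to `y` on the free bond system `latticeBonds Λ`
gives a family of unit chains from `(π x, 0)` to `(π y, 0)` on the bond system of the space-time
torus `(ℤ/Lℤ)^d × ℤ/Mℤ`, with the same pairwise overlaps (each edge `{u, u + eᵢ} ⊂ Λ` is sent to the
torus bond `((π u, 0), i)`). [folklore] -/
theorem exists_unitChain_latticeBonds_to_torus {L M : ℕ} [NeZero L] [NeZero M] (Λ : Finset (Site d))
    (hinj : Set.InjOn (Torus.proj (d := d) L) (Λ : Set (Site d))) {x y : ↥Λ} {S : Type*}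
    (Tch : S → (latticeBonds Λ).UnitChain x y) :
    ∃ T' : S → (JCurrent.bondSystem d L M).UnitChain
        ((Torus.proj L (x : Site d), 0) : JCurrent.SpaceTimeSite d L M) ((Torus.proj L (y : Site d), 0)),
      ∀ s s', (T' s).overlap (T' s') = (Tch s).overlap (Tch s') := by
  classical
  let G := latticeBonds Λ
  let G' := JCurrent.bondSystem d L M
  let g : ↥Λ → JCurrent.SpaceTimeSite d L M := fun z => (Torus.proj L (z : Site d), 0)
  -- source, target, axis and orientation of a bond of `Λ`
  set u : ↥(edgesIn (zdGraph d) Λ) → Site d := fun a => (G.src a : Site d) with hu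
  set w : ↥(edgesIn (zdGraph d) Λ) → Site d := fun a => (G.tgt a : Site d) with hw
  have hadj : ∀ a, ∃ i : Fin d, w a = u a + Pi.single i 1 ∨ u a = w a + Pi.single i 1 := by
    intro a
    have h := (mem_edgesIn_iff.1 a.2).1
    rw [← mk_src_tgt Λ a, SimpleGraph.mem_edgeSet] at h
    exact (zdGraph_adj_iff _ _).1 h
  choose i hi using hadj
  set fwd : ↥(edgesIn (zdGraph d) Λ) → Prop := fun a => w a = u a + Pi.single (i a) 1 with hfwd
  have hbwd : ∀ a, ¬ fwd a → u a = w a + Pi.single (i a) 1 := fun a h => (hi a).resolve_left h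
  set f : ↥(edgesIn (zdGraph d) Λ) → JCurrent.Bond d L M := fun a =>
    if fwd a then ((Torus.proj L (u a), 0), some (i a)) else ((Torus.proj L (w a), 0), some (i a)) with hf
  set ε : ↥(edgesIn (zdGraph d) Λ) → ℤ := fun a => if fwd a then 1 else -1 with hε
  have hε1 : ∀ a, ε a = 1 ∨ ε a = -1 := fun a => by simp only [hε]; split_ifs <;> simp
  -- the unit step on the torus
  have hstep : ∀ (z : Site d) (j : Fin d), ((Torus.proj L z, 0) : JCurrent.SpaceTimeSite d L M) +
      JCurrent.unitVec (some j) = (Torus.proj L (z + Pi.single j 1), 0) := fun z j => by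
    simp only [JCurrent.unitVec, Prod.mk_add_mk, add_zero, torusProj_add_single_one]
  -- compatibility of the bond characters
  have hcompat : ∀ a (θ' : JCurrent.SpaceTimeSite d L M → Circle),
      ((G'.bondChar (f a) θ' : Circle) : ℂ) = ((G.bondChar a (θ' ∘ g) : Circle) : ℂ) ^ ε a := by
    intro a θ'
    simp only [hf, hε]
    by_cases h : fwd a
    · rw [if_pos h, if_pos h, zpow_one, BondSystem.bondChar_apply, BondSystem.bondChar_apply,
        BondSystem.bondVar_one, BondSystem.bondVar_one]
      show (((θ' (Torus.proj L (u a), 0))⁻¹ * θ' (((Torus.proj L (u a), 0) : JCurrent.SpaceTimeSite d L M) +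
        JCurrent.unitVec (some (i a))) : Circle) : ℂ) = (((θ' (g (G.src a)))⁻¹ * θ' (g (G.tgt a)) : Circle) : ℂ)
      rw [hstep]
      have : u a + Pi.single (i a) 1 = w a := h.symm
      rw [this]
    · rw [if_neg h, if_neg h, BondSystem.bondChar_apply, BondSystem.bondChar_apply,
        BondSystem.bondVar_one, BondSystem.bondVar_one, zpow_neg, zpow_one, ← Circle.coe_inv, mul_inv_rev, inv_inv]
      show (((θ' (Torus.proj L (w a), 0))⁻¹ * θ' (((Torus.proj L (w a), 0) : JCurrent.SpaceTimeSite d L M) +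
        JCurrent.unitVec (some (i a))) : Circle) : ℂ) = (((θ' (g (G.tgt a)))⁻¹ * θ' (g (G.src a)) : Circle) : ℂ)
      rw [hstep, ← hbwd a h]
  -- injectivity of the bond map
  have hmemu : ∀ a, u a ∈ (Λ : Set (Site d)) := fun a => (G.src a).2
  have hmemw : ∀ a, w a ∈ (Λ : Set (Site d)) := fun a => (G.tgt a).2
  have hedge : ∀ a : ↥(edgesIn (zdGraph d) Λ), (a : Sym2 (Site d)) = s(u a, w a) := fun a => (mk_src_tgt Λ a).symm
  have hfinj : Function.Injective f := by
    intro a b hab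
    simp only [hf] at hab
    apply Subtype.ext
    rw [hedge, hedge]
    by_cases ha : fwd a <;> by_cases hb : fwd b <;> simp only [ha, hb, if_true, if_false, Prod.mk.injEq,
      Option.some.injEq] at hab <;> obtain ⟨⟨hp, -⟩, hii⟩ := hab
    · have hp' := hinj (hmemu a) (hmemu b) hp
      rw [ha, hb, ← hii, hp']
    · have hp' := hinj (hmemu a) (hmemw b) hp
      rw [ha, hbwd b hb, ← hii, hp', Sym2.eq_swap]
    · have hp' := hinj (hmemw a) (hmemu b) hp
      rw [hbwd a ha, hb, ← hii, hp', Sym2.eq_swap]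
    · have hp' := hinj (hmemw a) (hmemw b) hp
      rw [hbwd a ha, hbwd b hb, ← hii, hp']
  exact G.exists_unitChain_map G' g hfinj ε hε1 hcompat Tch

/-- **The closed ball `B((x+y)/2, 2‖x−y‖₂) ∩ ℤ^d` as a finite set** (squared form of the condition,
as in `GarbanSpencer2022_xyLongRangeOrder`). [folklore] -/
theorem exists_ball_finset (x y : Site d) :
    ∃ Λ : Finset (Site d), ∀ z : Site d, z ∈ Λ ↔
      (∑ i, ((z i : ℝ) - ((x i : ℝ) + (y i : ℝ)) / 2) ^ 2) ≤ 4 * ∑ i, ((x i : ℝ) - (y i : ℝ)) ^ 2 := by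
  classical
  set D : ℝ := ∑ i, ((x i : ℝ) - (y i : ℝ)) ^ 2 with hD
  set c : Fin d → ℝ := fun i => ((x i : ℝ) + (y i : ℝ)) / 2 with hc
  set R : ℕ := ⌈(∑ i, |c i|) + Real.sqrt (4 * D)⌉₊ with hR
  refine ⟨(box d R).filter fun z => (∑ i, ((z i : ℝ) - c i) ^ 2) ≤ 4 * D, fun z => ?_⟩
  rw [Finset.mem_filter, and_iff_right_iff_imp]
  intro hz
  rw [mem_box]
  intro k
  have hk : ((z k : ℝ) - c k) ^ 2 ≤ 4 * D :=
    (Finset.single_le_sum (f := fun i => ((z i : ℝ) - c i) ^ 2) (fun i _ => sq_nonneg _) (Finset.mem_univ k)).trans hz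
  have h1 : |(z k : ℝ) - c k| ≤ Real.sqrt (4 * D) := Real.abs_le_sqrt hk
  have h2 : |c k| ≤ ∑ i, |c i| := Finset.single_le_sum (f := fun i => |c i|) (fun i _ => abs_nonneg _) (Finset.mem_univ k)
  have h3 : |(z k : ℝ)| ≤ R := by
    calc |(z k : ℝ)| ≤ |(z k : ℝ) - c k| + |c k| := by
          have := abs_add_le ((z k : ℝ) - c k) (c k); rwa [sub_add_cancel] at this
      _ ≤ (∑ i, |c i|) + Real.sqrt (4 * D) := by linarith
      _ ≤ R := Nat.le_ceil _
  have h4 := abs_le.1 h3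
  constructor
  · exact_mod_cast h4.1
  · exact_mod_cast h4.2

/-- **The projection to the torus is injective on the ball** `B((x+y)/2, 2‖x−y‖₂) ∩ ℤ^d` as soon as
`16‖x − y‖₂² < L²`: two points of the ball differ by less than `L` in every coordinate. [folklore] -/
theorem torusProj_injOn_of_ball {L : ℕ} (x y : Site d)
    (hL : 16 * ∑ i, ((x i : ℝ) - (y i : ℝ)) ^ 2 < (L : ℝ) ^ 2) (Λ : Finset (Site d))
    (hΛ : ∀ z ∈ Λ, (∑ i, ((z i : ℝ) - ((x i : ℝ) + (y i : ℝ)) / 2) ^ 2) ≤ 4 * ∑ i, ((x i : ℝ) - (y i : ℝ)) ^ 2) :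
    Set.InjOn (Torus.proj (d := d) L) (Λ : Set (Site d)) := by
  intro z hz z' hz' hzz
  funext k
  have hk : ((z k : ℤ) : ZMod L) = ((z' k : ℤ) : ZMod L) := congrFun hzz k
  rw [ZMod.intCast_eq_intCast_iff_dvd_sub] at hk
  set D : ℝ := ∑ i, ((x i : ℝ) - (y i : ℝ)) ^ 2 with hD
  set c : Fin d → ℝ := fun i => ((x i : ℝ) + (y i : ℝ)) / 2 with hc
  have b1 : ((z k : ℝ) - c k) ^ 2 ≤ 4 * D :=
    (Finset.single_le_sum (f := fun i => ((z i : ℝ) - c i) ^ 2) (fun i _ => sq_nonneg _)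
      (Finset.mem_univ k)).trans (hΛ z (Finset.mem_coe.1 hz))
  have b2 : ((z' k : ℝ) - c k) ^ 2 ≤ 4 * D :=
    (Finset.single_le_sum (f := fun i => ((z' i : ℝ) - c i) ^ 2) (fun i _ => sq_nonneg _)
      (Finset.mem_univ k)).trans (hΛ z' (Finset.mem_coe.1 hz'))
  have b3 : ((z' k : ℝ) - (z k : ℝ)) ^ 2 < (L : ℝ) ^ 2 := by
    nlinarith [sq_nonneg (((z' k : ℝ) - c k) + ((z k : ℝ) - c k))]
  have b4 : |(z' k : ℝ) - (z k : ℝ)| < L := abs_lt_of_sq_lt_sq b3 (Nat.cast_nonneg L)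
  have hlt : |z' k - z k| < (L : ℤ) := by
    have h := abs_lt.1 b4
    rw [abs_lt]
    constructor
    · exact_mod_cast h.1
    · exact_mod_cast h.2
  have h0 := Int.eq_zero_of_abs_lt_dvd hk hlt
  linarith

end Torus

end Literature.Probability.LatticeModels
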